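import Literature.Barriers.QuantumFields.GoldstoneTheoremGNS
import Literature.Barriers.QuantumFields.GoldstoneTheoremProofs
import HarnessLib

/-!
# Goldstone's theorem (Kastler–Robinson–Swieca 1966) — discharge of the named fact

`Literature.Barriers.QuantumFields.GoldstoneTheorem` (file `GoldstoneTheorem`, the barrier
"a mass gap forbids the spontaneous breaking of a symmetry generated by a local conserved current")
is the Theorem of §IV of Kastler–Robinson–Swieca, *Conserved currents and associated symmetries;
Goldstone's theorem*, Commun. Math. Phys. **2** (1966) 108–120, (56)–(59): under assumptions
1.–6. the automorphisms `A ↦ A^τ` are implemented by a unitary group `U(τ)` with `U(τ) Ω = Ω`.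

The printed proof has two halves, both in the tree:
* §III, Lemma IV (47): `lim_{R → ∞} (Ω, [j⁰(f_R f_d), A] Ω) = 0` for strictly local `A` under the
  gap — `KRSLemmaIV_holds` (`GoldstoneTheoremProofs`, with `GoldstoneTheoremLemmaI`,
  `GoldstoneTheoremSpectral`, `GoldstoneTheoremTensor`);
* §IV, (60)–(71): by 6(b) and Lemma IV the order parameter `d/dτ (Ω, A^τ Ω)` vanishes, the state
  is invariant, and the GNS construction implements the automorphisms unitarily —
  `goldstoneTheorem_of_KRSLemmaIV : KRSLemmaIV → GoldstoneTheorem` (`GoldstoneTheoremGNS`).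

This file only assembles them: `GoldstoneTheorem_holds`.

## References

[KastlerRobinsonSwieca1966]
-/

open scoped InnerProductSpace

namespace Literature.Barriers.QuantumFields

/-- **Goldstone's theorem in the form of Kastler–Robinson–Swieca (1966), Theorem §IV** —
discharge of the named fact `GoldstoneTheorem`: as a consequence of assumptions 1.–6. (`IsKRS`,
`IsLocallyGeneratedSymmetry`) the automorphisms `A ↦ A^τ` are unitarily implementable by a group
`U(τ)` with `U(τ + τ') = U(τ) U(τ')`, `U(τ)* = U(-τ)`, `U(τ) Ω = Ω` and `A^τ = U(τ) A U(τ)⁻¹` on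
the quasi-local algebra ((56)–(59)); Lemma IV (`KRSLemmaIV_holds`) fed into the §IV argument
(`goldstoneTheorem_of_KRSLemmaIV`). [cite: KastlerRobinsonSwieca1966, §IV Theorem (56)-(59)] -/
theorem GoldstoneTheorem_holds : GoldstoneTheorem :=
  goldstoneTheorem_of_KRSLemmaIV KRSLemmaIV_holds

/-! ### Unconditional corollaries (barrier audit 2026-08-16)

With the named fact discharged, the barrier's consequences hold outright. They are recorded here
in the three forms in which a route meets them: the technique class is empty; every locally
generated symmetry of a KRS net has invariant vacuum expectation values; and assumption 6. is
consistent with 1.–5. for every net (the identity group is generated, in the sense of (7), by any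
conserved current — the content of Lemma IV). What the class does NOT contain (discrete
symmetries, a single massless flavour, the chiral limit as a limiting tool, unbroken chiral
symmetry) is spelled out in the BARRIER block of `GoldstoneTheorem`. -/

open LocalNetWithCurrent in
/-- **The technique class is empty, unconditionally**: no datum `N` satisfying KRS 1.–5. with
smallest mass `m > 0` carries a one-parameter automorphism group satisfying 6. together with a
non-invariant vacuum expectation value of a quasi-local operator
(`GoldstoneTheorem_holds` fed into `GoldstoneTheorem.not_isGappedBrokenSymmetry`).
[cite: KastlerRobinsonSwieca1966, Abstract and §IV Theorem] -/
theorem not_isGappedBrokenSymmetry_holds (N : LocalNetWithCurrent) (m : ℝ)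
    (α : ℝ → (N.H →L[ℂ] N.H) → (N.H →L[ℂ] N.H)) : ¬ IsGappedBrokenSymmetry N m α :=
  GoldstoneTheorem_holds.not_isGappedBrokenSymmetry N m α

/-- **(60), unconditionally**: in a KRS net with a mass gap every symmetry group locally generated
by the conserved current leaves all vacuum expectation values of quasi-local operators invariant,
`(Ω, A^τ Ω) = (Ω, A Ω)` — "a 'spontaneously broken symmetry' is possible only in the event that
the smallest mass is zero". [cite: KastlerRobinsonSwieca1966, §IV (60) and Abstract] -/
theorem LocalNetWithCurrent.IsLocallyGeneratedSymmetry.vev_invariant {N : LocalNetWithCurrent}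
    {m : ℝ} {α : ℝ → (N.H →L[ℂ] N.H) → (N.H →L[ℂ] N.H)} (hN : N.IsKRS m)
    (hα : N.IsLocallyGeneratedSymmetry α) (τ : ℝ) {A : N.H →L[ℂ] N.H} (hA : A ∈ N.quasiLocal) :
    ⟪N.Ω, α τ A N.Ω⟫_ℂ = ⟪N.Ω, A N.Ω⟫_ℂ :=
  GoldstoneTheorem_holds.vev_invariant N m α hN hα τ hA

/-- **Assumption 6. is consistent with 1.–5. for every net**: under `IsKRS m` the identity group
`A^τ = A` is a locally generated symmetry — its order parameter `d/dτ (Ω, A^τ Ω)|₀ = 0` is the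
limit of the charge commutators `(Ω, [j⁰(f_R f_d), A] Ω)` because these die out for every
strictly local `A` and every family `f_R ⊗ f_d` (Lemma IV, `KRSLemmaIV_holds`). In particular the
hypotheses of `GoldstoneTheorem` are jointly satisfiable over any KRS datum, and the class
`IsLocallyGeneratedSymmetry N` is never empty. [cite: KastlerRobinsonSwieca1966, §III Lemma IV (47)] -/
theorem LocalNetWithCurrent.IsKRS.isLocallyGeneratedSymmetry_id {N : LocalNetWithCurrent} {m : ℝ}
    (hN : N.IsKRS m) : N.IsLocallyGeneratedSymmetry (fun _ A => A) where
  maps_quasiLocal _ _ hA := hA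
  map_add _ _ _ _ _ := rfl
  map_smul _ _ _ _ := rfl
  map_mul _ _ _ _ _ := rfl
  map_star _ _ _ := rfl
  map_zero_left _ _ := rfl
  map_add_left _ _ _ _ := rfl
  continuous _ _ := continuous_const
  preserves_local _ _ _ hA := hA
  generated A hA δ hδ F hF :=
    ⟨0, hasDerivAt_const (0 : ℝ) _, KRSLemmaIV_holds N m hN A hA δ hδ F hF⟩

end Literature.Barriers.QuantumFields
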